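import Summits.QuantumAdvantage.AdviceFreeQNC0.R1CellReads39
import HarnessLib

/-!
# Cell qa-qnc0, `p = 3` — (R1) up to the CO-READ DEGREE of the outside letters (Caro–Wei form of the transversal method;
# prover qn-prover-3 g26, sequel of `R1CellReads39`)

Two outside letters CONFLICT (are co-read) if some bell reads both.  The transversal form of (R1)
(`AffBells22.norm_twistedWinSum_le_of_transversal`, qn-prover-3 g25) needs an independent set of twisted outside letters in this conflict
graph; the tree's Caro–Wei lemma `AffBells23.exists_indep_caroWei` (planner p1 g23) supplies one of size `≥ #P/(Δ + 1)` when every twisted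
outside letter conflicts with at most `Δ` other twisted outside letters (DISTINCT co-read partners — multiplicities of the reading sets
are irrelevant).  Hence:

* **`AffBells22.norm_twistedWinSum_le_of_coDegree`** — bells reading `T k`, `W` arbitrary, every letter outside `W` co-read with at most
  `Δ` other letters outside `W` ⇒ `‖Σ_x e₃(β·x)[OddZeros x ∧ Rel x (g x)]‖ ≤ 2·(39/40)^{#(supp β ∖ W)/(Δ+1)}·2^N` (`N ≥ 3`);
* **`GradedSeeds38.twistedJuntaBoundX3S_of_coDegree`** — (R1) `TwistedJuntaBoundX3S (39/40)` VERBATIM + "every letter outside `W` has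
  fewer than `(log₂N)^C` co-read partners outside `W`" (`A = 1`, `n₀ = 3`); this contains the equal-or-disjoint / cell-confined classes
  of `R1CellReads39` (co-degree `≤ #cell − 1`) and, read at level `C' ≥ C`, the bounded-multiplicity class of `R1PairMass39`
  (reads `≤ (log₂N)^C`, multiplicity `≤ m` ⇒ co-degree `≤ m·((log₂N)^C − 1) < (log₂N)^{C'}` once `m ≤ (log₂N)^{C'−C}`), with the plain
  rate `39/40` instead of `ρ_m`;
* **`GradedSeeds38.seedJuntaHardXS_of_coDegree`** — the structured branch for this class, UNCONDITIONAL (one `θ < 1`, every `C`).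

The residual regime of (R1) in this language: outside letters with `≥ (log₂N)^C` DISTINCT co-read partners each, on which moreover all
`d`-cap numbers are small (`R1CellReads39.norm_twistedWinSum_le_of_capSet`).

WHAT THIS IS NOT: nothing for high co-degree; crux `stmt-QuantumAdvantage-22907` untouched.
-/

noncomputable section

namespace Summit.QuantumAdvantage.AdviceFreeQNC0

open Finset Literature.Computability.QuantumComplexity Literature.Computability.QuantumComplexity.RingHLF
open Literature.Computability.MetaComplexity
open scoped Classical

namespace AffBells22

variable {N : ℕ}

/-- **(R1) UP TO THE CO-READ DEGREE.**  If bell `k` reads only `T k` and every letter outside `W` is co-read (lies in a common `T k`)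
with at most `Δ` other letters outside `W`, then `‖Σ_x e₃(β·x)[OddZeros x ∧ Rel x (g x)]‖ ≤ 2·(39/40)^{#(supp β ∖ W)/(Δ+1)}·2^N`
(`N ≥ 3`; Caro–Wei independent set of the conflict graph on the twisted outside letters + the transversal form). -/
theorem norm_twistedWinSum_le_of_coDegree (hN : 3 ≤ N) (W : Finset (Fin N)) (T : Fin N → Finset (Fin N))
    (g : Fin N → (Fin N → Bool) → Bool) (hg : ∀ k, ReadsOnly (T k) (g k)) (Δ : ℕ)
    (hco : ∀ i : Fin N, i ∉ W →
      (univ.filter fun i' : Fin N => i' ≠ i ∧ i' ∉ W ∧ ∃ k, i ∈ T k ∧ i' ∈ T k).card ≤ Δ)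
    (β : Fin N → ZMod 3) :
    ‖∑ x : Fin N → Bool, (ZMod.stdAddChar (∑ i : Fin N, if x i then β i else 0) : ℂ) *
        (if (OddZeros x ∧ RingHLF.Rel x (fun k => g k x)) then (1 : ℂ) else 0)‖
      ≤ 2 * (39 / 40 : ℝ) ^ ((univ.filter fun j : Fin N => j ∉ W ∧ β j ≠ 0).card / (Δ + 1)) * (2 : ℝ) ^ N := by
  classical
  set P := univ.filter (fun j : Fin N => j ∉ W ∧ β j ≠ 0) with hPdef
  set S : Fin N → Finset (Fin N) := fun k => T k \ W with hSdef
  obtain ⟨A, hAP, hfree, hsum⟩ := AffBells23.exists_indep_caroWei (univ : Finset (Fin N)) S P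
  -- the conflict degree inside `P` is at most `Δ`
  have hdeg : ∀ p ∈ P, AffBells23.cdeg (univ : Finset (Fin N)) S P p ≤ Δ := by
    intro p hp
    have hpW : p ∉ W := (mem_filter.mp hp).2.1
    unfold AffBells23.cdeg
    refine le_trans (card_le_card fun q hq => ?_) (hco p hpW)
    simp only [Finset.mem_filter] at hq
    obtain ⟨hqP, hqp, k, _, hpk, hqk⟩ := hq
    have hpk' : p ∈ T k \ W := hpk
    have hqk' : q ∈ T k \ W := hqk
    exact mem_filter.mpr ⟨mem_univ _, hqp, (mem_sdiff.mp hqk').2, k, (mem_sdiff.mp hpk').1, (mem_sdiff.mp hqk').1⟩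
  -- hence `#P ≤ (Δ+1)·#A`
  have hPA : P.card ≤ (Δ + 1) * A.card := by
    have h1 : ∑ p ∈ P, (1 : ℝ) / ((Δ : ℝ) + 1) ≤ ∑ p ∈ P, (1 : ℝ) / (AffBells23.cdeg (univ : Finset (Fin N)) S P p + 1) := by
      refine sum_le_sum fun p hp => one_div_le_one_div_of_le (by positivity) ?_
      exact_mod_cast Nat.add_le_add_right (hdeg p hp) 1
    rw [sum_const, nsmul_eq_mul] at h1
    have h2 : (P.card : ℝ) * (1 / ((Δ : ℝ) + 1)) ≤ A.card := h1.trans hsum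
    have h3 : (P.card : ℝ) ≤ ((Δ : ℝ) + 1) * A.card := by
      rw [mul_one_div, div_le_iff₀ (by positivity)] at h2
      linarith
    exact_mod_cast h3
  have hA : ∀ k, (T k ∩ A).card ≤ 1 := by
    intro k
    have hsub : T k ∩ A ⊆ S k ∩ A := by
      intro j hj
      rw [mem_inter] at hj
      exact mem_inter.mpr ⟨mem_sdiff.mpr ⟨hj.1, (mem_filter.mp (hAP hj.2)).2.1⟩, hj.2⟩
    exact (card_le_card hsub).trans (AffBells23.card_inter_le_one_of_conflictFree hfree (mem_univ k))
  have hAβ : ∀ j ∈ A, β j ≠ 0 := fun j hj => (mem_filter.mp (hAP hj)).2.2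
  refine (norm_twistedWinSum_le_of_transversal hN T g hg β A hA hAβ).trans ?_
  have hdiv : P.card / (Δ + 1) ≤ A.card := Nat.div_le_of_le_mul hPA
  have hpow : (39 / 40 : ℝ) ^ A.card ≤ (39 / 40 : ℝ) ^ (P.card / (Δ + 1)) :=
    pow_le_pow_of_le_one (by norm_num) (by norm_num) hdiv
  have h2 : (0 : ℝ) ≤ (2 : ℝ) ^ N := by positivity
  nlinarith [hpow, h2]

end AffBells22

namespace GradedSeeds38

open AffBells22 TwistedJunta36

section RestrictedC

open scoped Classical in
/-- **The structured-branch reduction for a RESTRICTED (R1), level-dependent admissibility.**  `seedJuntaHard_of_restrictedR1`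
(`SeedJuntaRestricted39`, qn-prover-3 g25) verbatim, with the admissibility predicate `Q C N W T` allowed to depend on the level `C`
at which (R1) is invoked (the reduction consumes (R1) at level `C` only for the conclusion at level `C`).  Needed for classes whose
description involves `(log₂N)^C` (co-degree, cell size, cap numbers). -/
theorem seedJuntaHard_of_restrictedR1C (Q : ℕ → (N : ℕ) → Finset (Fin N) → (Fin N → Finset (Fin N)) → Prop)
    {ρ : ℝ} {α : ℕ} (hρ : 0 ≤ ρ) (hq : 3 * ρ ^ α < 1)
    (hTJ : ∀ C : ℕ, ∃ A n₀ : ℕ, ∀ N ≥ n₀,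
      ∀ (W : Finset (Fin N)) (T : Fin N → Finset (Fin N)) (g : Fin N → (Fin N → Bool) → Bool),
        3 * W.card ≤ N → (∀ k, (T k \ W).card ≤ (Nat.log 2 N) ^ C) → Q C N W T →
        (∀ k (x x' : Fin N → Bool), (∀ i ∈ T k, x i = x' i) → g k x = g k x') →
          ∀ β : Fin N → ZMod 3,
            ‖∑ x : Fin N → Bool, (ZMod.stdAddChar (∑ i : Fin N, if x i then β i else 0) : ℂ) *
                (if (OddZeros x ∧ RingHLF.Rel x (fun k => g k x)) then (1 : ℂ) else 0)‖
              ≤ (N : ℝ) ^ A * ρ ^ ((univ.filter fun i : Fin N => i ∉ W ∧ β i ≠ 0).card / (Nat.log 2 N) ^ C) * (2 : ℝ) ^ N) :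
    ∃ θ : ℝ, θ < 1 ∧ ∀ C : ℕ, ∃ D n₀ : ℕ, ∀ N ≥ n₀,
      ∀ (W : Finset (Fin N)) (R : ℕ) (c : Fin R → Fin N → ZMod 3) (T : Fin N → Finset (Fin N))
        (H : Fin N → (Fin R → ZMod 3) → (Fin N → Bool) → Bool),
        3 * W.card ≤ N → GradedSpreadOff W c (fun j => (Nat.log 2 N) ^ C * (α * (j.val + 1) + D * Nat.log 2 N)) →
        (∀ k, (T k \ W).card ≤ (Nat.log 2 N) ^ C) → Q C N W T →
        (∀ k v (x x' : Fin N → Bool), (∀ i ∈ T k, x i = x' i) → H k v x = H k v x') →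
          ((univ.filter fun x : Fin N → Bool =>
              OddZeros x ∧ RingHLF.Rel x (fun k => H k (LinForms.resVec c x) x)).card : ℝ)
            ≤ θ * (2 : ℝ) ^ (N - 1) := by
  classical
  obtain ⟨θ, hθ, hcover⟩ := AffBells34.coverPolylogHard
  refine ⟨(1 + θ) / 2, by linarith, fun C => ?_⟩
  obtain ⟨n₁, hn₁⟩ := hcover C
  obtain ⟨A, n₂, hn₂⟩ := hTJ C
  -- the ratio `q = 3ρ^α ∈ [0,1)` and `ρ^α ≤ 1/2`, `ρ ≤ 1`
  have hρα0 : 0 ≤ ρ ^ α := pow_nonneg hρ α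
  have hq0 : 0 ≤ 3 * ρ ^ α := by positivity
  have hρα : ρ ^ α ≤ 1 / 2 := by linarith
  have hρ1 : ρ ≤ 1 := by
    by_contra h
    have h1 : 1 ≤ ρ ^ α := one_le_pow₀ (le_of_lt (not_le.1 h))
    linarith
  have h1θ : 0 < (1 - θ) / 2 := by linarith
  -- the error constant
  obtain ⟨n₃, hn₃⟩ : ∃ n₃ : ℕ, (2 : ℝ) ^ (A + 2) * (3 * ρ ^ α / (1 - 3 * ρ ^ α)) / ((1 - θ) / 2) ≤ n₃ :=
    ⟨_, Nat.le_ceil _⟩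
  refine ⟨α * (A + 1), max (max n₁ n₂) (max n₃ 2), fun N hN W R c T H hW hspread hT hQ hH => ?_⟩
  have hN1 : n₁ ≤ N := le_trans (le_trans (le_max_left _ _) (le_max_left _ _)) hN
  have hN2 : n₂ ≤ N := le_trans (le_trans (le_max_right _ _) (le_max_left _ _)) hN
  have hN3 : n₃ ≤ N := le_trans (le_trans (le_max_left _ _) (le_max_right _ _)) hN
  have hNtwo : 2 ≤ N := le_trans (le_trans (le_max_right _ _) (le_max_right _ _)) hN
  have hNone : 1 ≤ N := by omega
  have hNpos : (0 : ℝ) < N := by exact_mod_cast hNone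
  set L : ℕ := Nat.log 2 N with hL
  set P : (Fin R → ZMod 3) → (Fin N → Bool) → Prop := fun v x =>
    OddZeros x ∧ RingHLF.Rel x (fun k => H k v x) with hP
  set Bj : Fin R → ℝ := fun j => (N : ℝ) ^ A * ρ ^ (α * (j.val + 1) + α * (A + 1) * L) * (2 : ℝ) ^ N with hBj
  have hBj0 : ∀ j, 0 ≤ Bj j := fun j => by positivity
  -- (a) main term: frozen seed residues give a `W`-tolerant polylog-junta strategy (`coverPolylogHard`)
  have ha : ∀ v : Fin R → ZMod 3,
      ∑ x : Fin N → Bool, (if P v x then (1 : ℝ) else 0) ≤ θ * (2 : ℝ) ^ (N - 1) := by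
    intro v
    have h := hn₁ N hN1 W T (fun k x => H k v x) hW hT (fun k => fun x x' hxx' => hH k v x x' hxx')
    rw [sum_boole]
    simpa [AffBells22.winCount, hP] using h
  -- (b) graded twisted sums: the RESTRICTED twisted junta bound (exponent `#(supp β ∖ W) / (log₂N)^C`)
  have hb : ∀ (v γ : Fin R → ZMod 3) (j : Fin R), IsTop γ j →
      ‖∑ x : Fin N → Bool, (ZMod.stdAddChar (∑ i, γ i * LinForms.resVec c x i) : ℂ) *
          ((if P v x then (1 : ℝ) else 0 : ℝ) : ℂ)‖ ≤ Bj j := by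
    intro v γ j hj
    set β : Fin N → ZMod 3 := fun m => ∑ i, γ i * c i m with hβ
    have hres : ∀ x : Fin N → Bool, ∑ i, γ i * LinForms.resVec c x i = ∑ m, if x m then β m else 0 := by
      intro x
      simp only [LinForms.resVec, hβ, mul_sum]
      rw [sum_comm]
      refine sum_congr rfl fun m _ => ?_
      split_ifs <;> simp
    have h := hn₂ N hN2 W T (fun k x => H k v x) hW hT hQ (fun k x x' hxx' => hH k v x x' hxx') β
    have hcast : ∀ x : Fin N → Bool, (((if P v x then (1 : ℝ) else 0 : ℝ)) : ℂ) = (if P v x then (1 : ℂ) else 0) := by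
      intro x; split_ifs <;> simp
    simp_rw [hres, hcast]
    refine le_trans (by simpa [hP] using h) ?_
    have hLC : 0 < L ^ C := by
      have hL1 : 1 ≤ L := by rw [hL]; exact Nat.le_log_of_pow_le (by norm_num) (by simpa using hNtwo)
      exact pow_pos (by omega) C
    have hw0 : L ^ C * (α * (j.val + 1) + α * (A + 1) * L) ≤ (univ.filter fun i : Fin N => i ∉ W ∧ β i ≠ 0).card :=
      hspread γ j hj
    have hw : α * (j.val + 1) + α * (A + 1) * L ≤ (univ.filter fun i : Fin N => i ∉ W ∧ β i ≠ 0).card / L ^ C := by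
      rw [Nat.le_div_iff_mul_le hLC, mul_comm]; exact hw0
    calc (N : ℝ) ^ A * ρ ^ ((univ.filter fun i : Fin N => i ∉ W ∧ β i ≠ 0).card / L ^ C) * (2 : ℝ) ^ N
        ≤ (N : ℝ) ^ A * ρ ^ (α * (j.val + 1) + α * (A + 1) * L) * (2 : ℝ) ^ N := by
          gcongr _ * ?_ * _
          exact pow_le_pow_of_le_one hρ hρ1 hw
      _ = Bj j := rfl
  -- the graded expansion
  have hmain := sum_le_max_add_graded (p := 3) (fun x : Fin N → Bool => LinForms.resVec c x)
    (fun v x => if P v x then (1 : ℝ) else 0) (θ * (2 : ℝ) ^ (N - 1)) Bj hBj0 ha hb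
  have hset : ((univ.filter fun x : Fin N → Bool =>
      OddZeros x ∧ RingHLF.Rel x (fun k => H k (LinForms.resVec c x) x)).card : ℝ)
      = ∑ x : Fin N → Bool, (if P (LinForms.resVec c x) x then (1 : ℝ) else 0) := by
    rw [sum_boole]
  rw [hset]
  refine hmain.trans ?_
  -- (c) the error term `Σ_j 3^{j+1} Bj j ≤ ((1-θ)/2)·2^{N-1}`
  have herr : ∑ j : Fin R, ((3 : ℕ) : ℝ) ^ (j.val + 1) * Bj j ≤ ((1 - θ) / 2) * (2 : ℝ) ^ (N - 1) := by
    have hterm : ∀ j : Fin R, ((3 : ℕ) : ℝ) ^ (j.val + 1) * Bj j =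
        (3 * ρ ^ α) ^ (j.val + 1) * ((N : ℝ) ^ A * (ρ ^ α) ^ ((A + 1) * L) * (2 : ℝ) ^ N) := by
      intro j
      have e1 : ρ ^ (α * (j.val + 1) + α * (A + 1) * L) = (ρ ^ α) ^ (j.val + 1) * (ρ ^ α) ^ ((A + 1) * L) := by
        rw [pow_add, pow_mul, mul_assoc, pow_mul]
      have eB : Bj j = (N : ℝ) ^ A * ρ ^ (α * (j.val + 1) + α * (A + 1) * L) * (2 : ℝ) ^ N := rfl
      rw [eB, e1, mul_pow]; push_cast; ring
    rw [sum_congr rfl fun j _ => hterm j, ← sum_mul]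
    have hN2 : (2 : ℝ) ^ N = 2 * (2 : ℝ) ^ (N - 1) := by
      rw [← pow_succ']; congr 1; omega
    have hgeo := sum_pow_succ_le_div (3 * ρ ^ α) hq0 hq R
    have hdec := pow_mul_decay_le N A hNone (ρ ^ α) hρα0 hρα
    have hq1 : 0 < 1 - 3 * ρ ^ α := by linarith
    have hK0 : 0 ≤ 3 * ρ ^ α / (1 - 3 * ρ ^ α) := div_nonneg hq0 hq1.le
    have hp : (0 : ℝ) ≤ (2 : ℝ) ^ (N - 1) := by positivity
    -- `N ≥ n₃` gives `2^{A+2} · (q/(1-q)) / N ≤ (1-θ)/2`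
    have hN3' : (2 : ℝ) ^ (A + 2) * (3 * ρ ^ α / (1 - 3 * ρ ^ α)) / ((1 - θ) / 2) ≤ N :=
      hn₃.trans (by exact_mod_cast hN3)
    have hkey : (2 : ℝ) ^ (A + 2) * (3 * ρ ^ α / (1 - 3 * ρ ^ α)) / N ≤ (1 - θ) / 2 := by
      rw [div_le_iff₀ hNpos]
      rw [div_le_iff₀ h1θ] at hN3'
      linarith
    calc (∑ j : Fin R, (3 * ρ ^ α) ^ (j.val + 1)) * ((N : ℝ) ^ A * (ρ ^ α) ^ ((A + 1) * L) * (2 : ℝ) ^ N)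
        ≤ (3 * ρ ^ α / (1 - 3 * ρ ^ α)) * ((2 : ℝ) ^ (A + 1) / N * (2 : ℝ) ^ N) := by
          refine mul_le_mul hgeo ?_ (by positivity) hK0
          exact mul_le_mul_of_nonneg_right hdec (by positivity)
      _ = ((2 : ℝ) ^ (A + 2) * (3 * ρ ^ α / (1 - 3 * ρ ^ α)) / N) * (2 : ℝ) ^ (N - 1) := by
          rw [hN2]; ring
      _ ≤ ((1 - θ) / 2) * (2 : ℝ) ^ (N - 1) := mul_le_mul_of_nonneg_right hkey hp
  have h3 : ∑ j : Fin R, ((3 : ℕ) : ℝ) ^ (j.val + 1) * Bj j = ∑ j : Fin R, (3 : ℝ) ^ (j.val + 1) * Bj j := by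
    push_cast; rfl
  linarith [herr]

end RestrictedC

/-- **(R1) `TwistedJunta36.TwistedJuntaBoundX3S (39/40)` UP TO CO-READ DEGREE** — the statement of (R1) verbatim with the single extra
hypothesis that every letter outside `W` has fewer than `(log₂N)^C` co-read partners outside `W` (`A = 1`, `n₀ = 3`; `3·#W ≤ N` unused).
Contains the equal-or-disjoint and cell-confined classes; multiplicities of the reading sets play no role. -/
theorem twistedJuntaBoundX3S_of_coDegree (C : ℕ) :
    ∃ A n₀ : ℕ, ∀ N ≥ n₀,
      ∀ (W : Finset (Fin N)) (T : Fin N → Finset (Fin N)) (g : Fin N → (Fin N → Bool) → Bool),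
        3 * W.card ≤ N → (∀ k, (T k \ W).card ≤ (Nat.log 2 N) ^ C) →
        (∀ i : Fin N, i ∉ W →
          (univ.filter fun i' : Fin N => i' ≠ i ∧ i' ∉ W ∧ ∃ k, i ∈ T k ∧ i' ∈ T k).card + 1 ≤ (Nat.log 2 N) ^ C) →
        (∀ k (x x' : Fin N → Bool), (∀ i ∈ T k, x i = x' i) → g k x = g k x') →
          ∀ β : Fin N → ZMod 3,
            ‖∑ x : Fin N → Bool, (ZMod.stdAddChar (∑ i : Fin N, if x i then β i else 0) : ℂ) *
                (if (OddZeros x ∧ RingHLF.Rel x (fun k => g k x)) then (1 : ℂ) else 0)‖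
              ≤ (N : ℝ) ^ A * (39 / 40 : ℝ) ^ ((univ.filter fun i : Fin N => i ∉ W ∧ β i ≠ 0).card / (Nat.log 2 N) ^ C)
                  * (2 : ℝ) ^ N := by
  classical
  refine ⟨1, 3, fun N hN W T g _hW _hT hco hg β => ?_⟩
  have hlog : 1 ≤ Nat.log 2 N := Nat.le_log_of_pow_le (by norm_num) (by omega)
  have hs : 1 ≤ (Nat.log 2 N) ^ C := Nat.one_le_pow _ _ hlog
  have hTr : ∀ k, ReadsOnly (T k) (g k) := fun k x x' h => hg k x x' h
  have hco' : ∀ i : Fin N, i ∉ W →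
      (univ.filter fun i' : Fin N => i' ≠ i ∧ i' ∉ W ∧ ∃ k, i ∈ T k ∧ i' ∈ T k).card ≤ (Nat.log 2 N) ^ C - 1 := by
    intro i hi; have := hco i hi; omega
  have h := norm_twistedWinSum_le_of_coDegree hN W T g hTr ((Nat.log 2 N) ^ C - 1) hco' β
  have hΔ1 : (Nat.log 2 N) ^ C - 1 + 1 = (Nat.log 2 N) ^ C := by omega
  rw [hΔ1] at h
  rw [pow_one]
  refine h.trans ?_
  have hN2 : (2 : ℝ) ≤ (N : ℝ) := by exact_mod_cast (show 2 ≤ N by omega)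
  have hpos : (0 : ℝ) ≤ (39 / 40 : ℝ) ^ ((univ.filter fun i : Fin N => i ∉ W ∧ β i ≠ 0).card / (Nat.log 2 N) ^ C)
      * (2 : ℝ) ^ N := by positivity
  nlinarith [hpos, hN2]

open scoped Classical in
/-- **THE STRUCTURED BRANCH UP TO CO-READ DEGREE — UNCONDITIONAL.**  Graded-spread seeds (schedule `(log₂N)^C·(50(j+1) + D·log₂N)`
outside `W`, `3·#W ≤ N`) ⊕ juntas reading `T k` with `#(T k ∖ W) ≤ (log₂N)^C` and every letter outside `W` co-read with fewer than
`(log₂N)^C` other letters outside `W`: `≤ θ·2^{N−1}` winning odd inputs, one `θ < 1`, every `C`, every number `R` of seeds. -/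
theorem seedJuntaHardXS_of_coDegree :
    ∃ θ : ℝ, θ < 1 ∧ ∀ C : ℕ, ∃ D n₀ : ℕ, ∀ N ≥ n₀,
      ∀ (W : Finset (Fin N)) (R : ℕ) (c : Fin R → Fin N → ZMod 3) (T : Fin N → Finset (Fin N))
        (H : Fin N → (Fin R → ZMod 3) → (Fin N → Bool) → Bool),
        3 * W.card ≤ N → GradedSpreadOff W c (fun j => (Nat.log 2 N) ^ C * (50 * (j.val + 1) + D * Nat.log 2 N)) →
        (∀ k, (T k \ W).card ≤ (Nat.log 2 N) ^ C) →
        (∀ i : Fin N, i ∉ W →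
          (univ.filter fun i' : Fin N => i' ≠ i ∧ i' ∉ W ∧ ∃ k, i ∈ T k ∧ i' ∈ T k).card + 1 ≤ (Nat.log 2 N) ^ C) →
        (∀ k v (x x' : Fin N → Bool), (∀ i ∈ T k, x i = x' i) → H k v x = H k v x') →
          ((univ.filter fun x : Fin N → Bool =>
              OddZeros x ∧ RingHLF.Rel x (fun k => H k (LinForms.resVec c x) x)).card : ℝ)
            ≤ θ * (2 : ℝ) ^ (N - 1) :=
  seedJuntaHard_of_restrictedR1C
    (fun C N W T => ∀ i : Fin N, i ∉ W →
      (univ.filter fun i' : Fin N => i' ≠ i ∧ i' ∉ W ∧ ∃ k, i ∈ T k ∧ i' ∈ T k).card + 1 ≤ (Nat.log 2 N) ^ C)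
    (ρ := 39 / 40) (α := 50) (by norm_num) three_mul_rho_pow_fifty_lt_one
    (fun C => twistedJuntaBoundX3S_of_coDegree C)

end GradedSeeds38

end Summit.QuantumAdvantage.AdviceFreeQNC0

end
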